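import Summits.ABC.IUTFork.Cor312LicenceWildExactRealising
import Summits.ABC.IUTFork.Repair.RHHullThresholdExact
import HarnessLib

/-!
# D-0079 RESCUE R-H × R-W, ROW 4 «hull-threshold-exact» made KERNEL on the NEGATIVE side: at the sharp print-normalised bed with REALISING
# ideles, if the closed-form column `HullCell` FAILS at the most favourable certified radii of ONE bad place, the (xi-f) licence FAILS

PROOF-ONLY file (D-0012: 0 definitions, 0 `Prop` facts; abc-iut cell, rung LADDER-ABC:A2.RESCUE.H / A2.RESCUE.W; seat abc-iut-rh-typ-4, R-H ROUND 1
PAIR n = 4, row 4 of `plan/rescue/R-H/RH-CANDIDATES.tsv`). TAKES NO SIDE on [IUTchIII] Cor. 3.12 or on any author: every statement is about OUR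
typed objects (abc-iut-c312-7's `Thm311.Real.settingPrVolSharp`, abc-iut-c312-5's `presAt` / typed (Ind1)(Ind2), abc-iut-c312-1's
`Thm311ToCor312.Licence`); the hull-level licence is a STRONGER-THAN-PRINT reading of Step (xi-f); typed ≠ proved; refuted-as-typed ≠
refuted-in-print; nothing here asserts abc proved or refuted.

WHAT. abc-iut-w4-d036's U2-LICENCE-WRAPPER (`licence_settingPrVolSharp_iff_shellRadii_of_realises`, p460573 ✓) decides the licence for realising
ideles by ONE ∀-form predicate per `(p, i, v⃗)` in the inner/outer shell radii `cin`, `cout` (binders `hin0/hin/hmax/hout0/houtΛ/hdom`) and the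
differents. Row 4's landed arithmetic bridge (`RH.HullThresholdExact.not_criterion_of_not_hullCell`, p459342 ✓) turns BOUNDS on those radii
into the integer column. THIS FILE composes the two at the DIAGONAL summand `v⃗ = (w, …, w)` of a bad place `w | p` with integral pilot degree
`P_q(w) = P`: **`not_licence_settingPrVolSharp_of_not_hullCell`** — if `p^{−r_in_ub/e_w} ≤ ‖cin w‖` (a certified LOWER bound on the inner
radius, e.g. `r_in_ub = ⌊e_w/(p−1)⌋+1` from `pBall_subset_logUnits_of_lt`, p451708, and the maximality `hmax`), `‖cout w‖ ≤ p^{−r_out_lb/e_w}` (an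
UPPER bound on the outer radius, e.g. abc-iut-rp-x2's sharp `r_out♯ = min_t(p^t − t·e_w)`, p454995), the different defects of the diagonal
packet are `≤ (i+1)·(e_w − 1)/e_w` (tame-type places, `differentOrd_le_differentOrd_dFac`), and `¬ HullCell e_w P (i+1) r_in_ub r_out_lb`, then
`¬ Thm311ToCor312.Licence (settingPrVolSharp X …)`; **`not_exists_qPinned_and_hull_settingPrVolSharp_of_not_hullCell`** — hence branch C's
per-datum antecedent «∃ ρ qK, QPinned ∧ PilotKummerCompatHull» (binder `hSHw`'s shape) FAILS. The three numeric hypotheses are BY-NAME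
dischargeable per local type; nothing about exact radii (U2-LATTICE-INTEGERS) is needed on this negative side (`not_hullCell_of_bounds`).
READING for the I06STAR-COLUMNS / WINDOW-TABLE (neutral): every «NEG-cert» cell of row 4's column (HOME/abc-iut-rh-typ-4/ROW4-K1-…tsv,
three-engine) at a genuine Dupuy–Hilado datum with realising ideles is a licence REFUTATION modulo the local inputs `(e_w, d_w ≤ (e_w−1)/e_w,
r_in_ub, r_out_lb)` BY NAME — the same status as R-W's [ED] rows (F1-3), at a sharper threshold.
[cite: Mochizuki2012, IUTchIII Cor. 3.12 p. 173–174, Step (xi-f) p. 184; IUTchIV Prop. 1.1 p. 9, Prop. 1.2 (i)(ii) p. 10]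
[cite: DupuyHilado2025, §3.3, §3.4, §4.9, §4.12] [claim: Mochizuki2012, status: disputed] for every IUT sentence quoted. Axioms: standard.
-/

noncomputable section

open Set Function
open scoped Pointwise TensorProduct

namespace Summit.ABC.IUTFork.Repair.RH.HullThresholdExactRefute

open Summit.ABC.IUTFork.Thm311 Summit.ABC.IUTFork.Thm311.Real Summit.ABC.IUTFork.Cor312 Summit.ABC.IUTFork.Cor312.Setting
  Summit.ABC.IUTFork.Cor312Vol Literature.IUT.LogThetaLattice Literature.IUT.LogVolume NumberField IsDedekindDomain
open Literature.NumberTheory.NumberFields Literature.NumberTheory.GaloisRepresentations.Ultrametric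
open Summit.ABC.IUTFork.Repair.RH.HullThresholdExact

variable {F : Type} [Field F] [NumberField F] (X : PilotData F) {logv : PadicLogs F} (hlog : LogvAnalytic logv)
  (M : Type) [Field M] [NumberField M]
  (archPk : ∀ (j : (thetaIndex X).Label) (vQ : (thetaIndex X).VQ), Set ((logShellsDH X logv).Packet j vQ))
  (archSub : ∀ (j : (thetaIndex X).Label) (v : (thetaIndex X).V),
    Set ((logShellsDH X logv).Packet j ((thetaIndex X).over v)))
  (Ψ : ℤ → ∀ v : (thetaIndex X).V, v ∈ (thetaIndex X).Vbad → Set ((logShellsDH X logv).StarPacket v))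
  (act : ℤ → ∀ v : (thetaIndex X).V, v ∈ (thetaIndex X).Vbad →
    (logShellsDH X logv).StarPacket v → Module.End ℚ ((logShellsDH X logv).StarPacket v))
  (Mmod : ℤ → ∀ j : (thetaIndex X).LabelStar, Set ((logShellsDH X logv).GlobalPacket j.1))
  (region : ℤ → ∀ j : (thetaIndex X).LabelStar, FinDivisor M → ∀ vQ : (thetaIndex X).VQ,
    Set ((logShellsDH X logv).Packet j.1 vQ))
  (n : ℤ) {HT : Type} {LogLink : HT → HT → Type} {IsFull : ∀ {s t : HT}, LogLink s t → Prop}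
  (lat : LGPGaussianLogThetaLattice LogLink IsFull)
  {Frd : Type} {IsoF : Frd → Frd → Type} {Ob : Frd → Type} {realify : Frd → Frd} {Strip : Type}
  {IsoS : Strip → Strip → Type} {Mv : ∀ v : (thetaIndex X).V, v ∈ (thetaIndex X).Vbad → Type}
  [∀ v h, Monoid (Mv v h)]
  (sig : GlobalLGPFrobenioidSignature (thetaIndex X).lstar (thetaIndex X).V (· ∈ (thetaIndex X).Vbad)
    Frd IsoF Ob realify Strip IsoS Mv)
  (split : SplittingMonoids Mv) {ObΔ : Type} {N : ∀ v : (thetaIndex X).V, v ∈ (thetaIndex X).Vbad → Type}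
  [∀ v h, Monoid (N v h)] (qData : QPilotData ObΔ N)
  (tq : ∀ (pp : Nat.Primes) (x : (thetaIndex X).Fibre (.inr pp)), haveI : Fact (pp : ℕ).Prime := ⟨pp.2⟩; kOf X pp.1 x)
  (t : ∀ (pp : Nat.Primes) (_ : Fin X.lstar) (x : (thetaIndex X).Fibre (.inr pp)),
    haveI : Fact (pp : ℕ).Prime := ⟨pp.2⟩; kOf X pp.1 x)
  (htq0 : ∀ pp x, tq pp x ≠ 0)
  (htq1 : ∀ (pp : Nat.Primes) (x : (thetaIndex X).Fibre (.inr pp)),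
    haveI : Fact (pp : ℕ).Prime := ⟨pp.2⟩; placeOf X pp.1 x ∉ X.S → ‖tq pp x‖ = 1)
  (col : ℤ → Column (logShellsDH X logv))
  (ht0 : ∀ pp i x, t pp i x ≠ 0)
  (ht : ∀ (pp : Nat.Primes) (i : Fin X.lstar) (x : (thetaIndex X).Fibre (.inr pp)),
    haveI : Fact (pp : ℕ).Prime := ⟨pp.2⟩
    Real.log ‖t pp i x‖ = -(X.thetaPilot i (placeOf X pp.1 x)) * logNorm F (placeOf X pp.1 x) /
      localDegree F (placeOf X pp.1 x))
  (htq : ∀ (pp : Nat.Primes) (x : (thetaIndex X).Fibre (.inr pp)),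
    haveI : Fact (pp : ℕ).Prime := ⟨pp.2⟩
    Real.log ‖tq pp x‖ = -(X.qPilot (placeOf X pp.1 x)) * logNorm F (placeOf X pp.1 x) /
      localDegree F (placeOf X pp.1 x))
  (cin cout : ∀ (pp : Nat.Primes) (x : (thetaIndex X).Fibre (.inr pp)),
    haveI : Fact (pp : ℕ).Prime := ⟨pp.2⟩; (presAt X hlog pp).k x)
  (hin0 : ∀ pp x, cin pp x ≠ 0)
  (hin : ∀ (pp : Nat.Primes) (x : (thetaIndex X).Fibre (.inr pp)), haveI : Fact (pp : ℕ).Prime := ⟨pp.2⟩;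
    ∀ o : (presAt X hlog pp).k x, ‖o‖ ≤ 1 → cin pp x * o ∈ logUnits ((presAt X hlog pp).k x))
  (hmax : ∀ (pp : Nat.Primes) (x : (thetaIndex X).Fibre (.inr pp)), haveI : Fact (pp : ℕ).Prime := ⟨pp.2⟩;
    ∃ (ϖ : ((presAt X hlog pp).k x)ˣ) (w : (presAt X hlog pp).k x),
      IsUniformizer ϖ ∧ w ∉ logUnits ((presAt X hlog pp).k x) ∧ ‖w‖ * ‖(ϖ : (presAt X hlog pp).k x)‖ ≤ ‖cin pp x‖)
  (hout0 : ∀ pp x, cout pp x ≠ 0)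
  (houtΛ : ∀ (pp : Nat.Primes) (x : (thetaIndex X).Fibre (.inr pp)), haveI : Fact (pp : ℕ).Prime := ⟨pp.2⟩;
    cout pp x ∈ logUnits ((presAt X hlog pp).k x))
  (hdom : ∀ (pp : Nat.Primes) (x : (thetaIndex X).Fibre (.inr pp)), haveI : Fact (pp : ℕ).Prime := ⟨pp.2⟩;
    ∀ z ∈ logUnits ((presAt X hlog pp).k x), ‖z‖ ≤ ‖cout pp x‖)

/-- `x^{n} = x^{n·a}`-type bookkeeping: `(p^{X/e})^N = p^{(N·X)/e}` for `p > 0`. [folklore] -/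
private theorem rpow_div_pow {p : ℕ} (hp : 0 < p) (e : ℝ) (Xr : ℝ) (N : ℕ) :
    ((p : ℝ) ^ (Xr / e)) ^ N = (p : ℝ) ^ (((N : ℝ) * Xr) / e) := by
  have hp0 : (0 : ℝ) ≤ p := by positivity
  rw [← Real.rpow_natCast, ← Real.rpow_mul hp0]
  congr 1
  ring

include ht0 ht htq hin0 hin hmax hout0 houtΛ hdom in
/-- **THE LICENCE FAILS WHEN ROW 4's COLUMN FAILS AT THE MOST FAVOURABLE CERTIFIED RADII OF ONE BAD PLACE.** Realising Θ- and q-ideles; a place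
`w | p` of the Θ-index fibre with integral pilot degree `P_q(w) = P`, ramification index `e = ramIdx F w`; a LOWER bound `p^{−r_in_ub/e} ≤ ‖cin w‖`
on abc-iut-w4-d036's inner radius and an UPPER bound `‖cout w‖ ≤ p^{−r_out_lb/e}` on his outer radius; the different defects of the DIAGONAL packet
`(w, …, w)` at label `i+1` bounded by `(i+1)·(e−1)/e` (tame-type `w`); and `¬ HullCell e P (i+1) r_in_ub r_out_lb`. THEN abc-iut-c312-1's
`Thm311ToCor312.Licence` FAILS at `settingPrVolSharp X …` — via `licence_settingPrVolSharp_iff_shellRadii_of_realises` (⟹, at the diagonal summand: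
the capsule permutation `σ` is invisible there) and `not_criterion_of_not_hullCell`. [cite: DupuyHilado2025, §3.4, §4.9, §4.12]
[cite: Mochizuki2012, IUTchIII Cor. 3.12 Step (xi-f) p. 184; IUTchIV Prop. 1.1 p. 9, Prop. 1.2 (i)(ii) p. 10] [claim: Mochizuki2012, status: disputed] -/
theorem not_licence_settingPrVolSharp_of_not_hullCell (pp : Nat.Primes) (i : Fin (thetaIndex X).lstar)
    (w : (thetaIndex X).Fibre (.inr pp)) {P : ℕ}
    (hP : haveI : Fact (pp : ℕ).Prime := ⟨pp.2⟩; X.qPilot (placeOf X pp.1 w) = P)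
    {rinUb routLb : ℤ}
    (hcin : haveI : Fact (pp : ℕ).Prime := ⟨pp.2⟩
      ((pp : ℕ) : ℝ) ^ (((-rinUb : ℤ) : ℝ) / ((ramIdx F (placeOf X pp.1 w) : ℤ) : ℝ)) ≤ ‖cin pp w‖)
    (hcout : haveI : Fact (pp : ℕ).Prime := ⟨pp.2⟩
      ‖cout pp w‖ ≤ ((pp : ℕ) : ℝ) ^ (((-routLb : ℤ) : ℝ) / ((ramIdx F (placeOf X pp.1 w) : ℤ) : ℝ)))
    (hd : haveI : Fact (pp : ℕ).Prime := ⟨pp.2⟩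
      ∀ J : DIdx (pp : ℕ) ((presAt X hlog pp).kk (fun _ : (thetaIndex X).Caps (Setting.labelSucc i) => w)),
        dSum (pp : ℕ) ((presAt X hlog pp).kk (fun _ : (thetaIndex X).Caps (Setting.labelSucc i) => w)) -
            differentOrd (pp : ℕ) (DFac (pp : ℕ) ((presAt X hlog pp).kk (fun _ : (thetaIndex X).Caps (Setting.labelSucc i) => w)) J) ≤
          (((((i : ℕ) : ℤ) + 1) * ((ramIdx F (placeOf X pp.1 w) : ℤ) - 1) : ℤ) : ℝ) / ((ramIdx F (placeOf X pp.1 w) : ℤ) : ℝ))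
    (hneg : haveI : Fact (pp : ℕ).Prime := ⟨pp.2⟩
      ¬ HullCell (ramIdx F (placeOf X pp.1 w) : ℤ) (P : ℤ) (((i : ℕ) : ℤ) + 1) rinUb routLb) :
    ¬ Thm311ToCor312.Licence (settingPrVolSharp X hlog M archPk archSub Ψ act Mmod region n lat sig split qData tq t htq0 htq1) := by
  haveI : Fact (pp : ℕ).Prime := ⟨pp.2⟩
  intro hL
  have hall := (licence_settingPrVolSharp_iff_shellRadii_of_realises X hlog M archPk archSub Ψ act Mmod region n lat sig split qData tq t
    htq0 htq1 ht0 ht htq cin cout hin0 hin hmax hout0 houtΛ hdom).1 hL pp i (fun _ => w)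
  obtain ⟨σ, hσ⟩ := hall
  -- abbreviations
  set e : ℤ := (ramIdx F (placeOf X pp.1 w) : ℤ) with he_def
  have he0' : 0 < ramIdx F (placeOf X pp.1 w) := Nat.pos_of_ne_zero (ramIdx_ne_zero F _)
  have he : 0 < e := by rw [he_def]; exact_mod_cast he0'
  have hp1 : 1 < (pp : ℕ) := pp.2.one_lt
  have hp0 : 0 < (pp : ℕ) := pp.2.pos
  have hP0 : (0 : ℝ) ≤ ((pp : ℕ) : ℝ) := by positivity
  have hcard : Fintype.card ((thetaIndex X).Caps (Setting.labelSucc i)) = (i : ℕ) + 2 := by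
    rw [Fintype.card_fin]
    simp only [Setting.labelSucc, Fin.val_succ]
  -- the products of the (constant) radii
  have hPin : ((pp : ℕ) : ℝ) ^ (((-(((((i : ℕ) : ℤ) + 1) + 1) * rinUb) : ℤ) : ℝ) / (e : ℝ)) ≤
      ∏ _a : (thetaIndex X).Caps (Setting.labelSucc i), ‖cin pp w‖ := by
    rw [Finset.prod_const, Finset.card_univ, hcard]
    have h1 : (((pp : ℕ) : ℝ) ^ (((-rinUb : ℤ) : ℝ) / (e : ℝ))) ^ ((i : ℕ) + 2) ≤ ‖cin pp w‖ ^ ((i : ℕ) + 2) :=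
      pow_le_pow_left₀ (Real.rpow_nonneg hP0 _) hcin _
    rw [rpow_div_pow hp0] at h1
    convert h1 using 2
    push_cast; ring
  have hPout : ∏ _a : (thetaIndex X).Caps (Setting.labelSucc i), ‖cout pp w‖ ≤
      ((pp : ℕ) : ℝ) ^ (((-(((((i : ℕ) : ℤ) + 1) + 1) * routLb) : ℤ) : ℝ) / (e : ℝ)) := by
    rw [Finset.prod_const, Finset.card_univ, hcard]
    have h1 : ‖cout pp w‖ ^ ((i : ℕ) + 2) ≤ (((pp : ℕ) : ℝ) ^ (((-routLb : ℤ) : ℝ) / (e : ℝ))) ^ ((i : ℕ) + 2) :=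
      pow_le_pow_left₀ (norm_nonneg _) hcout _
    rw [rpow_div_pow hp0] at h1
    convert h1 using 2
    push_cast; ring
  -- the realising norms in the bridge's currency
  have htq' : ((pp : ℕ) : ℝ) ^ (-(X.qPilot (placeOf X pp.1 w)) / (ramIdx F (placeOf X pp.1 w) : ℝ)) =
      ((pp : ℕ) : ℝ) ^ (((-(P : ℤ) : ℤ) : ℝ) / (e : ℝ)) := by
    rw [hP]; congr 1; push_cast; rw [he_def]; push_cast; ring
  have htΘ' : ((pp : ℕ) : ℝ) ^ (-((((i : ℕ) + 1 : ℕ) : ℝ) ^ 2 * X.qPilot (placeOf X pp.1 w)) / (ramIdx F (placeOf X pp.1 w) : ℝ)) =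
      ((pp : ℕ) : ℝ) ^ (((-((((i : ℕ) : ℤ) + 1) ^ 2 * (P : ℤ)) : ℤ) : ℝ) / (e : ℝ)) := by
    rw [hP]; congr 1; push_cast; rw [he_def]; push_cast; ring
  -- the bridge
  refine not_criterion_of_not_hullCell (p := (pp : ℕ)) (ι := DIdx (pp : ℕ) ((presAt X hlog pp).kk
      (fun _ : (thetaIndex X).Caps (Setting.labelSucc i) => w))) hp1 he (D := fun J =>
      dSum (pp : ℕ) ((presAt X hlog pp).kk (fun _ : (thetaIndex X).Caps (Setting.labelSucc i) => w)) -
        differentOrd (pp : ℕ) (DFac (pp : ℕ) ((presAt X hlog pp).kk (fun _ : (thetaIndex X).Caps (Setting.labelSucc i) => w)) J))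
    htq' htΘ' hPin hPout ?_ hneg ?_
  · intro J
    have := hd J
    convert this using 2
  · intro m hm
    have := hσ m (fun J => by simpa using hm J)
    simpa using this


include ht0 ht htq hin0 hin hmax hout0 houtΛ hdom in
/-- **… hence BRANCH C's per-datum antecedent FAILS**: under the same hypotheses, there are NO `ρ`, `qK` with `QPinned ∧ PilotKummerCompatHull` at
`settingPrVolSharp X …` (any columns `col`) — the binder `hSHw`'s shape of the window certificates is REFUTED at the datum (realising q-ideles
have norm `≤ 1`, `norm_qIdele_le_one_of_realises`; `exists_qPinned_and_hull_settingPrVolSharp_iff_licence`). [cite: DupuyHilado2025, §3.4, §4.9, §4.12]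
[cite: Mochizuki2012, IUTchIII Cor. 3.12 Step (xi-d) p. 183, (xi-f) p. 184] [claim: Mochizuki2012, status: disputed] -/
theorem not_exists_qPinned_and_hull_settingPrVolSharp_of_not_hullCell (pp : Nat.Primes) (i : Fin (thetaIndex X).lstar)
    (w : (thetaIndex X).Fibre (.inr pp)) {P : ℕ}
    (hP : haveI : Fact (pp : ℕ).Prime := ⟨pp.2⟩; X.qPilot (placeOf X pp.1 w) = P)
    {rinUb routLb : ℤ}
    (hcin : haveI : Fact (pp : ℕ).Prime := ⟨pp.2⟩
      ((pp : ℕ) : ℝ) ^ (((-rinUb : ℤ) : ℝ) / ((ramIdx F (placeOf X pp.1 w) : ℤ) : ℝ)) ≤ ‖cin pp w‖)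
    (hcout : haveI : Fact (pp : ℕ).Prime := ⟨pp.2⟩
      ‖cout pp w‖ ≤ ((pp : ℕ) : ℝ) ^ (((-routLb : ℤ) : ℝ) / ((ramIdx F (placeOf X pp.1 w) : ℤ) : ℝ)))
    (hd : haveI : Fact (pp : ℕ).Prime := ⟨pp.2⟩
      ∀ J : DIdx (pp : ℕ) ((presAt X hlog pp).kk (fun _ : (thetaIndex X).Caps (Setting.labelSucc i) => w)),
        dSum (pp : ℕ) ((presAt X hlog pp).kk (fun _ : (thetaIndex X).Caps (Setting.labelSucc i) => w)) -
            differentOrd (pp : ℕ) (DFac (pp : ℕ) ((presAt X hlog pp).kk (fun _ : (thetaIndex X).Caps (Setting.labelSucc i) => w)) J) ≤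
          (((((i : ℕ) : ℤ) + 1) * ((ramIdx F (placeOf X pp.1 w) : ℤ) - 1) : ℤ) : ℝ) / ((ramIdx F (placeOf X pp.1 w) : ℤ) : ℝ))
    (hneg : haveI : Fact (pp : ℕ).Prime := ⟨pp.2⟩
      ¬ HullCell (ramIdx F (placeOf X pp.1 w) : ℤ) (P : ℤ) (((i : ℕ) : ℤ) + 1) rinUb routLb) :
    ¬ ∃ (ρ : (∀ v : (thetaIndex X).V, v ∈ (thetaIndex X).Vbad → Set ((logShellsDH X logv).StarPacket v)) →
          ∀ (j : (thetaIndex X).Label) (vQ : (thetaIndex X).VQ), Set ((logShellsDH X logv).Packet j vQ))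
        (qK : ∀ v : (thetaIndex X).V, v ∈ (thetaIndex X).Vbad → Set ((logShellsDH X logv).StarPacket v)),
        QPinned ({ toSituation := situationPrVol X hlog M archPk archSub Ψ act Mmod region, col := col } :
            LatticeSituation (thetaIndex X))
          (settingPrVolSharp X hlog M archPk archSub Ψ act Mmod region n lat sig split qData tq t htq0 htq1) ρ qK ∧
        PilotKummerCompatHull ({ toSituation := situationPrVol X hlog M archPk archSub Ψ act Mmod region, col := col } :
            LatticeSituation (thetaIndex X))
          (settingPrVolSharp X hlog M archPk archSub Ψ act Mmod region n lat sig split qData tq t htq0 htq1) ρ qK := by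
  intro h
  have hL := (exists_qPinned_and_hull_settingPrVolSharp_iff_licence X hlog M archPk archSub Ψ act Mmod region n lat sig split qData tq t
    htq0 htq1 col (fun pp x => norm_qIdele_le_one_of_realises X tq htq0 htq pp x)).1 h
  exact not_licence_settingPrVolSharp_of_not_hullCell X hlog M archPk archSub Ψ act Mmod region n lat sig split qData tq t htq0 htq1 ht0 ht
    htq cin cout hin0 hin hmax hout0 houtΛ hdom pp i w hP hcin hcout hd hneg hL

end Summit.ABC.IUTFork.Repair.RH.HullThresholdExactRefute

end
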